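import Literature.MathematicalPhysics.QuantumLattice.HubbardEffectiveActionCT

/-!
# Crux `SeededBrokenRegimeBoseFermiPinned` (stmt-HubbardSuperconductivity-14047), line `seed-strength-flow`:
# Gaussian additivity of the countertermed effective action in the seed (stub `stub_seedConvolution`, S2)

Support file (`--supports stmt-HubbardSuperconductivity-14047`), the second lemma of the line
`seed-strength-flow`.  In the countertermed Wilsonian effective action of the seeded Hubbard torus,
`hubbardEffectiveActionCT L M β U μ h K Λ = effAction ℂ (hubbardCovAboveCT L M β μ h K Λ) (hubbardInteractionCT L M β U K)`
(`hubbardEffectiveActionCT_def`), the Koma–Tasaki pair seed `h` sits ONLY in the covariance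
`hubbardCovAboveCT L M β μ h K Λ`: the interaction slot `hubbardInteractionCT L M β U K` (Hubbard vertex plus
counterterm) and Salmhofer's cutoff weight `hubbardCutoffWeightCT L M β μ K Λ` are `h`-free.  Hence, at fixed
scale `Λ₀` and finite `(L, M, β)`, the effective action at seed `h` is reached from the one at an anchor seed
`h₀` by ONE Grassmann Gaussian convolution with the seed-slice covariance `C^{>Λ₀}_h − C^{>Λ₀}_{h₀}`:

  `𝒢_h = effAction ℂ (C^{>Λ₀}_h − C^{>Λ₀}_{h₀}) 𝒢_{h₀}`   whenever `Z_{h₀} ≠ 0`,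

which is Salmhofer's semigroup property of effective actions (Salmhofer 1999, §2.5.1 (2.106)), the tree
lemma `effAction_add`, applied to the splitting `C^{>Λ₀}_h = (C^{>Λ₀}_h − C^{>Λ₀}_{h₀}) + C^{>Λ₀}_{h₀}`; the
unit hypothesis of `effAction_add` is `Z_{h₀} ≠ 0` in the field `ℂ` (`isUnit_iff_ne_zero`).  No new
definitions, no analysis.
-/

set_option linter.dupNamespace false -- Summit.<S>.<S> doubles the summit name (tree convention)

namespace Summit.HubbardSuperconductivity.HubbardSuperconductivity.Theorems.AposterioriCapRgSeededBrokenRegimeBoseFermiPinned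

open Literature.MathematicalPhysics.QuantumLattice Literature.Probability.LatticeModels GrassmannAlgebra

/-- **S2 (`SeedConvolution`), Gaussian additivity in the seed**: for the seeded Hubbard torus
(`L`, Matsubara cutoff `M`, `β`, `U`, `μ`) in the counterterm frame `K` at infrared scale `Λ₀`, if the
normalised partition function at the anchor seed `h₀` does not vanish, `Z^K_{Λ₀}(h₀) ≠ 0`, then the
effective action at any seed `h` is the effective action of the one at seed `h₀` after integrating out the
seed-slice covariance `C^{>Λ₀}_h − C^{>Λ₀}_{h₀}`:
`𝒢^K_{Λ₀}(h) = effAction ℂ (C^{>Λ₀}_h − C^{>Λ₀}_{h₀}) (𝒢^K_{Λ₀}(h₀))`.  This is (2.106) of Salmhofer with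
`C₁ = C^{>Λ₀}_h − C^{>Λ₀}_{h₀}`, `C₂ = C^{>Λ₀}_{h₀}` and the `h`-free interaction `V_K`.
[cite: Salmhofer1999, §2.5.1 (2.106)] -/
theorem stub_seedConvolution :
    ∀ (L M : ℕ) [NeZero L] (β U μ h h₀ : ℝ) (K : TrigPolyC4v) (Λ₀ : ℝ),
      hubbardEffPartitionFnCT L M β U μ h₀ K Λ₀ ≠ 0 →
        hubbardEffectiveActionCT L M β U μ h K Λ₀ =
          effAction ℂ (hubbardCovAboveCT L M β μ h K Λ₀ - hubbardCovAboveCT L M β μ h₀ K Λ₀)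
            (hubbardEffectiveActionCT L M β U μ h₀ K Λ₀) := by
  intro L M _ β U μ h h₀ K Λ₀ hZ
  -- Salmhofer (2.106) for `C₁ = C_h - C_{h₀}`, `C₂ = C_{h₀}`, `V = V_K` (the `h`-free interaction slot)
  have hadd := effAction_add ℂ (hubbardCovAboveCT L M β μ h K Λ₀ - hubbardCovAboveCT L M β μ h₀ K Λ₀)
    (hubbardCovAboveCT L M β μ h₀ K Λ₀) (hubbardInteractionCT L M β U K) (isUnit_iff_ne_zero.2 hZ)
  rw [sub_add_cancel] at hadd
  rw [hubbardEffectiveActionCT_def, hubbardEffectiveActionCT_def, hadd]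

end Summit.HubbardSuperconductivity.HubbardSuperconductivity.Theorems.AposterioriCapRgSeededBrokenRegimeBoseFermiPinned
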